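/-
Copyright: harness tree, Literature layer (sorry-free). b2b-lace enum2-g13 (ENUMERATION SHARD B gen 13),
GAPS G8 (δ2)(i) M3: SEEDCERT kernel evaluator — semantics of the computable layer.
-/
import Literature.Probability.FitznerVanDerHofstad2017.SrwSeedCertKernel
import Literature.Probability.FitznerVanDerHofstad2017.SrwLawKernelCount
import Literature.Probability.FitznerVanDerHofstad2017.SrwLawBesselEGF
import Literature.Probability.FitznerVanDerHofstad2017.SrwIntegralBesselUSplit

/-!
# SEEDCERT kernel evaluator: semantics of the list kernels and of the walk-count layer

The computable layer (`SrwSeedCertKernel`) evaluates, per coordinate class, (i) the product of eleven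
dyadically scaled bracket polynomials and its termwise tail integrals, and (ii) the hat half-table of
the binomial dimension recursion followed by the Horner sums `P_n`, `U_n`.  This file proves what those
`ℕ`/`ℤ`/`ℚ`-list computations MEAN:

* polynomial semantics of the list kernels: `toPolyN`/`toPolyZ`/`toPolyQ`, `toPolyN_convPN`
  (`convPN` is multiplication by a signed list on (positive, negative) pairs), `toPolyN_loProdPN` /
  `toPolyN_upProdPN` (the folded products ARE the products of the scaled bracket polynomials),
  `cast_scaleZ` / `toPolyZ_loListZ` (dyadic scaling is exact under `dyadicOK`), `eval_toPolyQ_loList` /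
  `eval_toPolyQ_upList` (the bracket polynomials `Σ_{i<a+J+1} mcoef_i w^i ∓ ε w^{J+1}`), `tailInt_eq`
  (the accumulated tail integral is the termwise sum `Σ_i (p_i - q_i)·2/((e₀+2i) t^{e₀+2i})`);
* the walk-count layer: `getD_convN` (truncated Cauchy coefficient), `hatRow1_getD`
  (`Mf/(k!(k+a)!)` by the ratio recursion), `G_support` (the counts `SrwCount.G x j m` live on the
  parity lattice `m = 2i + A_j`), `hat_step_identity` (the exponential-generating-function form of the
  dimension recursion `G_{j+1}(m) = Σ_ℓ C(m,ℓ) walk1(ℓ,b) G_j(m-ℓ)` restricted to the parity lattice),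
  `wHatFold_spec` (**`Ŵ_k = M̂!·G_11(2k+A)/(2k+A)!`**), `hornerAux_eq`, `facSeq_getD`, `expSeq_getD`
  (`A_j = j!·E_{j+1}(λ)`), and finally **`Cert.Pq_real` / `Cert.Uq_real`**:
  `P_n = Σ_{m<M n} C(m+n',n') p_m(x;11)` and `U_n = Σ_{m<M n} C(m+n',n') p_m(x;11) E_{m+n'+1}(λ)`
  with `p_m = srwLaw 11 m x` (`srwLaw_eq_srwCount_div`), for `x` the padded coordinate vector of the
  certificate; `Cert.params_of_paramsOK` unpacks the Boolean parameter check.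

No analysis here (that is `SrwSeedCertSound`); nothing is evaluated by the kernel in this file.

[cite: FitznerVanDerHofstad2016NoBLE, §5.1.1 (5.4)–(5.5) pp. 1089–1090]
-/
/-! Sound layer 1 (dev): list → polynomial semantics of the `[T,∞)` product kernels. -/

open Polynomial Finset

namespace Literature.Probability.FitznerVanDerHofstad2017.SeedCert

/-! ### Lists as polynomials -/

/-- `[a₀, a₁, …] ↦ a₀ + a₁ X + ⋯` over `ℝ` (from `ℕ` coefficients). [folklore] -/
noncomputable def toPolyN : List ℕ → ℝ[X]
  | [] => 0
  | a :: as => C (a : ℝ) + X * toPolyN as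

/-- `[a₀, a₁, …] ↦ a₀ + a₁ X + ⋯` over `ℝ` (from `ℤ` coefficients). [folklore] -/
noncomputable def toPolyZ : List ℤ → ℝ[X]
  | [] => 0
  | a :: as => C (a : ℝ) + X * toPolyZ as

/-- `[a₀, a₁, …] ↦ a₀ + a₁ X + ⋯` over `ℝ` (from `ℚ` coefficients). [folklore] -/
noncomputable def toPolyQ : List ℚ → ℝ[X]
  | [] => 0
  | a :: as => C (a : ℝ) + X * toPolyQ as

/-- Semantics lemma `toPolyN_nil` of the SEEDCERT evaluator soundness proof (list-kernel / walk-count layer; see the module docstring). [folklore] -/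
@[simp] theorem toPolyN_nil : toPolyN [] = 0 := rfl
/-- Semantics lemma `toPolyN_cons` of the SEEDCERT evaluator soundness proof (list-kernel / walk-count layer; see the module docstring). [folklore] -/
@[simp] theorem toPolyN_cons (a : ℕ) (as : List ℕ) : toPolyN (a :: as) = C (a : ℝ) + X * toPolyN as := rfl
/-- Semantics lemma `toPolyZ_nil` of the SEEDCERT evaluator soundness proof (list-kernel / walk-count layer; see the module docstring). [folklore] -/
@[simp] theorem toPolyZ_nil : toPolyZ [] = 0 := rfl
/-- Semantics lemma `toPolyZ_cons` of the SEEDCERT evaluator soundness proof (list-kernel / walk-count layer; see the module docstring). [folklore] -/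
@[simp] theorem toPolyZ_cons (a : ℤ) (as : List ℤ) : toPolyZ (a :: as) = C (a : ℝ) + X * toPolyZ as := rfl
/-- Semantics lemma `toPolyQ_nil` of the SEEDCERT evaluator soundness proof (list-kernel / walk-count layer; see the module docstring). [folklore] -/
@[simp] theorem toPolyQ_nil : toPolyQ [] = 0 := rfl
/-- Semantics lemma `toPolyQ_cons` of the SEEDCERT evaluator soundness proof (list-kernel / walk-count layer; see the module docstring). [folklore] -/
@[simp] theorem toPolyQ_cons (a : ℚ) (as : List ℚ) : toPolyQ (a :: as) = C (a : ℝ) + X * toPolyQ as := rfl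

/-- Evaluation of a coefficient list: `Σ_{i<|l|} l_i w^i`. [folklore] -/
theorem toPolyN_eval (l : List ℕ) (w : ℝ) :
    (toPolyN l).eval w = ∑ i ∈ range l.length, ((l.getD i 0 : ℕ) : ℝ) * w ^ i := by
  induction l with
  | nil => simp
  | cons a as ih =>
      rw [toPolyN_cons, eval_add, eval_C, eval_mul, eval_X, ih, List.length_cons, sum_range_succ',
        mul_sum]
      simp only [List.getD_cons_succ, List.getD_cons_zero, pow_zero, mul_one, pow_succ]
      rw [add_comm]
      congr 1
      exact sum_congr rfl fun i _ => by ring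

/-- Semantics lemma `toPolyQ_eval` of the SEEDCERT evaluator soundness proof (list-kernel / walk-count layer; see the module docstring). [folklore] -/
theorem toPolyQ_eval (l : List ℚ) (w : ℝ) :
    (toPolyQ l).eval w = ∑ i ∈ range l.length, ((l.getD i 0 : ℚ) : ℝ) * w ^ i := by
  induction l with
  | nil => simp
  | cons a as ih =>
      rw [toPolyQ_cons, eval_add, eval_C, eval_mul, eval_X, ih, List.length_cons, sum_range_succ',
        mul_sum]
      simp only [List.getD_cons_succ, List.getD_cons_zero, pow_zero, mul_one, pow_succ]
      rw [add_comm]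
      congr 1
      exact sum_congr rfl fun i _ => by ring

/-- `Σ`-form of a `range`-generated list. [folklore] -/
theorem toPolyQ_range_map_eval (f : ℕ → ℚ) (n : ℕ) (w : ℝ) :
    (toPolyQ ((List.range n).map f)).eval w = ∑ i ∈ range n, ((f i : ℚ) : ℝ) * w ^ i := by
  rw [toPolyQ_eval, List.length_map, List.length_range]
  refine sum_congr rfl fun i hi => ?_
  have hi' : i < n := by simpa using hi
  simp [List.getD_eq_getElem?_getD, List.getElem?_range hi']

/-! ### The list kernels as polynomial operations -/

/-- Semantics lemma `toPolyN_zipAddN` of the SEEDCERT evaluator soundness proof (list-kernel / walk-count layer; see the module docstring). [folklore] -/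
theorem toPolyN_zipAddN : ∀ a b : List ℕ, toPolyN (zipAddN a b) = toPolyN a + toPolyN b
  | [], b => by simp [zipAddN]
  | x :: xs, [] => by simp [zipAddN]
  | x :: xs, y :: ys => by
      rw [zipAddN, toPolyN_cons, toPolyN_cons, toPolyN_cons, toPolyN_zipAddN xs ys]
      simp only [Nat.cast_add, C_add]; ring

/-- Semantics lemma `toPolyN_smulN` of the SEEDCERT evaluator soundness proof (list-kernel / walk-count layer; see the module docstring). [folklore] -/
theorem toPolyN_smulN (c : ℕ) : ∀ v : List ℕ, toPolyN (smulN c v) = C (c : ℝ) * toPolyN v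
  | [] => by simp [smulN]
  | x :: xs => by
      rw [smulN, toPolyN_cons, toPolyN_cons, toPolyN_smulN c xs]
      simp only [Nat.cast_mul, C_mul]; ring

/-- Semantics lemma `toPolyN_consAdd` of the SEEDCERT evaluator soundness proof (list-kernel / walk-count layer; see the module docstring). [folklore] -/
theorem toPolyN_consAdd (a r : List ℕ) : toPolyN (consAdd a r) = toPolyN a + X * toPolyN r := by
  cases a with
  | nil => simp [consAdd]
  | cons p ps => rw [consAdd, toPolyN_cons, toPolyN_cons, toPolyN_zipAddN]; ring

/-- **The signed product kernel is a polynomial product.** [folklore] -/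
theorem toPolyN_convPN : ∀ (q : List ℤ) (pp pn : List ℕ),
    toPolyN (convPN q pp pn).1 - toPolyN (convPN q pp pn).2 = toPolyZ q * (toPolyN pp - toPolyN pn)
  | [], pp, pn => by simp [convPN]
  | c :: us, pp, pn => by
      have ih := toPolyN_convPN us pp pn
      cases c with
      | ofNat k =>
          simp only [convPN, toPolyN_consAdd, toPolyN_smulN, toPolyZ_cons, Int.ofNat_eq_natCast,
            Int.cast_natCast]
          rw [show toPolyN (convPN us pp pn).1 = toPolyZ us * (toPolyN pp - toPolyN pn)
              + toPolyN (convPN us pp pn).2 by rw [← ih]; ring]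
          ring
      | negSucc k =>
          simp only [convPN, toPolyN_consAdd, toPolyN_smulN, toPolyZ_cons, Int.cast_negSucc,
            Nat.cast_add, Nat.cast_one]
          rw [show toPolyN (convPN us pp pn).1 = toPolyZ us * (toPolyN pp - toPolyN pn)
              + toPolyN (convPN us pp pn).2 by rw [← ih]; ring]
          simp only [C_neg, C_add, C_1]
          ring

/-- Semantics lemma `forceN_eq` of the SEEDCERT evaluator soundness proof (list-kernel / walk-count layer; see the module docstring). [folklore] -/
theorem forceN_eq (l : List ℕ) : forceN l = l := by simp [forceN, Nat.beq_refl]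

/-- Semantics lemma `forcePN_eq` of the SEEDCERT evaluator soundness proof (list-kernel / walk-count layer; see the module docstring). [folklore] -/
theorem forcePN_eq (r : List ℕ × List ℕ) : forcePN r = r := by simp [forcePN, Nat.beq_refl]

/-- **The lower product kernel is the product of the factor polynomials.** [folklore] -/
theorem toPolyN_loProdPN (J : ℕ) (eps : ℕ → ℚ) (S : ℕ) : ∀ as : List ℕ,
    toPolyN (loProdPN J eps S as).1 - toPolyN (loProdPN J eps S as).2
      = (as.map fun a => toPolyZ (loListZ a J (eps a) S)).prod
  | [] => by simp [loProdPN]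
  | a :: as => by
      rw [loProdPN, forcePN_eq, toPolyN_convPN, toPolyN_loProdPN J eps S as, List.map_cons,
        List.prod_cons]

/-- Semantics lemma `toPolyN_upProdPN` of the SEEDCERT evaluator soundness proof (list-kernel / walk-count layer; see the module docstring). [folklore] -/
theorem toPolyN_upProdPN (J : ℕ) (eps : ℕ → ℚ) (S : ℕ) : ∀ as : List ℕ,
    toPolyN (upProdPN J eps S as).1 - toPolyN (upProdPN J eps S as).2
      = (as.map fun a => toPolyZ (upListZ a J (eps a) S)).prod
  | [] => by simp [upProdPN]
  | a :: as => by
      rw [upProdPN, forcePN_eq, toPolyN_convPN, toPolyN_upProdPN J eps S as, List.map_cons,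
        List.prod_cons]

/-- A dyadic rational: `q · 2^S ∈ ℤ` gives `scaleZ S q = q · 2^S`. [folklore] -/
theorem cast_scaleZ {S : ℕ} {q : ℚ} (h : dyadicOK S q = true) :
    ((scaleZ S q : ℤ) : ℚ) = q * 2 ^ S := by
  unfold dyadicOK at h
  unfold scaleZ
  have hden : (q * 2 ^ S).den = 1 := by simpa using h
  exact (Rat.den_eq_one_iff _).mp hden

/-- Semantics lemma `toPolyZ_map_scaleZ` of the SEEDCERT evaluator soundness proof (list-kernel / walk-count layer; see the module docstring). [folklore] -/
theorem toPolyZ_map_scaleZ (S : ℕ) : ∀ (l : List ℚ), (∀ q ∈ l, dyadicOK S q = true) →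
    toPolyZ (l.map (scaleZ S)) = C ((2 : ℝ) ^ S) * toPolyQ l
  | [], _ => by simp
  | q :: qs, h => by
      have hq : dyadicOK S q = true := h q (by simp)
      have hqs : ∀ q' ∈ qs, dyadicOK S q' = true := fun q' hq' => h q' (by simp [hq'])
      rw [List.map_cons, toPolyZ_cons, toPolyQ_cons, toPolyZ_map_scaleZ S qs hqs]
      have hc : ((scaleZ S q : ℤ) : ℝ) = (q : ℝ) * 2 ^ S := by
        have h1 : (((scaleZ S q : ℤ) : ℚ) : ℝ) = ((q * 2 ^ S : ℚ) : ℝ) := by rw [cast_scaleZ hq]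
        rw [Rat.cast_intCast] at h1
        rw [h1]; push_cast; ring
      rw [hc, C_mul, C_pow, C_ofNat]
      ring

end Literature.Probability.FitznerVanDerHofstad2017.SeedCert


namespace Literature.Probability.FitznerVanDerHofstad2017.SeedCert

open Polynomial Finset
open Literature.Probability.LatticeModels (bracketCoeffQ invSqrtCoeffQ invSqrtCoeffQ' tHalfCoeff
  tHalfCoeff_eq_zero_of_lt)

/-! ### Lengths and coefficients -/

/-- Semantics lemma `length_zipAddN` of the SEEDCERT evaluator soundness proof (list-kernel / walk-count layer; see the module docstring). [folklore] -/
theorem length_zipAddN : ∀ a b : List ℕ, (zipAddN a b).length = max a.length b.length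
  | [], b => by simp [zipAddN]
  | x :: xs, [] => by simp [zipAddN]
  | x :: xs, y :: ys => by simp [zipAddN, length_zipAddN xs ys, Nat.succ_max_succ]

/-- Semantics lemma `length_smulN` of the SEEDCERT evaluator soundness proof (list-kernel / walk-count layer; see the module docstring). [folklore] -/
theorem length_smulN (c : ℕ) : ∀ v : List ℕ, (smulN c v).length = v.length
  | [] => rfl
  | x :: xs => by simp [smulN, length_smulN c xs]

/-- Semantics lemma `length_consAdd` of the SEEDCERT evaluator soundness proof (list-kernel / walk-count layer; see the module docstring). [folklore] -/
theorem length_consAdd (a r : List ℕ) : (consAdd a r).length = max a.length (r.length + 1) := by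
  cases a with
  | nil => simp [consAdd]
  | cons p ps => simp [consAdd, length_zipAddN, Nat.succ_max_succ]

/-- Semantics lemma `length_convPN` of the SEEDCERT evaluator soundness proof (list-kernel / walk-count layer; see the module docstring). [folklore] -/
theorem length_convPN : ∀ (q : List ℤ) (pp pn : List ℕ), pp.length = pn.length →
    (convPN q pp pn).1.length = (convPN q pp pn).2.length
  | [], pp, pn, _ => by simp [convPN]
  | c :: us, pp, pn, h => by
      have ih := length_convPN us pp pn h
      cases c with
      | ofNat k => simp [convPN, length_consAdd, length_smulN, h, ih]
      | negSucc k => simp [convPN, length_consAdd, length_smulN, h, ih]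

/-- Semantics lemma `length_loProdPN` of the SEEDCERT evaluator soundness proof (list-kernel / walk-count layer; see the module docstring). [folklore] -/
theorem length_loProdPN (J : ℕ) (eps : ℕ → ℚ) (S : ℕ) : ∀ as : List ℕ,
    (loProdPN J eps S as).1.length = (loProdPN J eps S as).2.length
  | [] => by simp [loProdPN]
  | a :: as => by
      rw [loProdPN, forcePN_eq]
      exact length_convPN _ _ _ (length_loProdPN J eps S as)

/-- Semantics lemma `length_upProdPN` of the SEEDCERT evaluator soundness proof (list-kernel / walk-count layer; see the module docstring). [folklore] -/
theorem length_upProdPN (J : ℕ) (eps : ℕ → ℚ) (S : ℕ) : ∀ as : List ℕ,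
    (upProdPN J eps S as).1.length = (upProdPN J eps S as).2.length
  | [] => by simp [upProdPN]
  | a :: as => by
      rw [upProdPN, forcePN_eq]
      exact length_convPN _ _ _ (length_upProdPN J eps S as)

/-- Evaluation of a signed pair of equal lengths. [folklore] -/
theorem eval_pair_sub (p n : List ℕ) (h : p.length = n.length) (w : ℝ) :
    (toPolyN p - toPolyN n).eval w
      = ∑ i ∈ range p.length, (((p.getD i 0 : ℕ) : ℝ) - ((n.getD i 0 : ℕ) : ℝ)) * w ^ i := by
  rw [eval_sub, toPolyN_eval, toPolyN_eval, ← h, ← sum_sub_distrib]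
  exact sum_congr rfl fun i _ => by ring

/-! ### The tail integral evaluator -/

/-- Semantics lemma `tailIntAux_eq` of the SEEDCERT evaluator soundness proof (list-kernel / walk-count layer; see the module docstring). [folklore] -/
theorem tailIntAux_eq (t : ℕ) : ∀ (p n : List ℕ) (e : ℕ) (acc : ℚ), p.length = n.length →
    tailIntAux t p n e acc
      = acc + ∑ i ∈ range p.length,
          (((p.getD i 0 : ℕ) : ℚ) - ((n.getD i 0 : ℕ) : ℚ)) * 2 / (((e + 2 * i : ℕ) : ℚ) * (t : ℚ) ^ (e + 2 * i))
  | [], [], e, acc, _ => by simp [tailIntAux]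
  | [], _ :: _, e, acc, h => by simp at h
  | _ :: _, [], e, acc, h => by simp at h
  | p :: ps, q :: qs, e, acc, h => by
      have h' : ps.length = qs.length := by simpa using h
      rw [tailIntAux, tailIntAux_eq t ps qs (e + 2) _ h', List.length_cons, sum_range_succ']
      simp only [List.getD_cons_succ, List.getD_cons_zero, mul_zero, add_zero]
      have : ∀ i : ℕ, e + 2 + 2 * i = e + 2 * (i + 1) := fun i => by ring
      simp only [this]
      ring

/-- Semantics lemma `tailInt_eq` of the SEEDCERT evaluator soundness proof (list-kernel / walk-count layer; see the module docstring). [folklore] -/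
theorem tailInt_eq (t : ℕ) (pl : List ℕ × List ℕ) (e₀ : ℕ) (h : pl.1.length = pl.2.length) :
    tailInt t pl e₀ = ∑ i ∈ range pl.1.length,
      (((pl.1.getD i 0 : ℕ) : ℚ) - ((pl.2.getD i 0 : ℕ) : ℚ)) * 2
        / (((e₀ + 2 * i : ℕ) : ℚ) * (t : ℚ) ^ (e₀ + 2 * i)) := by
  rw [tailInt, tailIntAux_eq t pl.1 pl.2 e₀ 0 h, zero_add]

/-! ### The factor polynomials -/

/-- Semantics lemma `bracketCoeffQ_eq_zero` of the SEEDCERT evaluator soundness proof (list-kernel / walk-count layer; see the module docstring). [folklore] -/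
theorem bracketCoeffQ_eq_zero {a J i : ℕ} (hi : a + J < i) : bracketCoeffQ a J i = 0 := by
  unfold bracketCoeffQ
  refine sum_eq_zero fun k hk => ?_
  by_cases hka : a < k
  · rw [tHalfCoeff_eq_zero_of_lt a k hka, zero_mul]
  · have : ¬ (i - k ≤ J) := by push Not at hka ⊢; omega
    simp [invSqrtCoeffQ', this]

/-- Semantics lemma `mcoef_eq_zero` of the SEEDCERT evaluator soundness proof (list-kernel / walk-count layer; see the module docstring). [folklore] -/
theorem mcoef_eq_zero {a J i : ℕ} (hi : a + J < i) : mcoef a J i = 0 := by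
  simp [mcoef, bracketCoeffQ_eq_zero hi]

/-- The lower factor polynomial evaluates to `Σ_{i<a+J+1} mcoef_i w^i - ε w^{J+1}`. [folklore] -/
theorem eval_toPolyQ_loList (a J : ℕ) (eps : ℚ) (w : ℝ) :
    (toPolyQ (loList a J eps)).eval w
      = ∑ i ∈ range (a + J + 1), ((mcoef a J i : ℚ) : ℝ) * w ^ i - (eps : ℝ) * w ^ (J + 1) := by
  rw [loList, toPolyQ_range_map_eval]
  have hsplit : ∀ i, (((mcoef a J i - if i = J + 1 then eps else 0 : ℚ) : ℝ)) * w ^ i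
      = ((mcoef a J i : ℚ) : ℝ) * w ^ i - (if i = J + 1 then (eps : ℝ) * w ^ (J + 1) else 0) := by
    intro i; split_ifs with h <;> simp [h, sub_mul]
  simp only [hsplit, sum_sub_distrib]
  have hJ : J + 1 < blen a J := by unfold blen; omega
  rw [sum_ite_eq' (range (blen a J)) (J + 1), if_pos (mem_range.mpr hJ)]
  congr 1
  -- the main coefficients vanish beyond `a + J`
  have hle : a + J + 1 ≤ blen a J := by unfold blen; omega
  rw [← sum_range_add_sum_Ico _ hle]
  rw [sum_eq_zero (s := Ico _ _) fun i hi => by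
    rw [mem_Ico] at hi; rw [mcoef_eq_zero (by omega)]; simp, add_zero]

/-- The upper factor polynomial evaluates to `Σ_{i<a+J+1} mcoef_i w^i + ε w^{J+1}`. [folklore] -/
theorem eval_toPolyQ_upList (a J : ℕ) (eps : ℚ) (w : ℝ) :
    (toPolyQ (upList a J eps)).eval w
      = ∑ i ∈ range (a + J + 1), ((mcoef a J i : ℚ) : ℝ) * w ^ i + (eps : ℝ) * w ^ (J + 1) := by
  rw [upList, toPolyQ_range_map_eval]
  have hsplit : ∀ i, (((mcoef a J i + if i = J + 1 then eps else 0 : ℚ) : ℝ)) * w ^ i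
      = ((mcoef a J i : ℚ) : ℝ) * w ^ i + (if i = J + 1 then (eps : ℝ) * w ^ (J + 1) else 0) := by
    intro i; split_ifs with h <;> simp [h, add_mul]
  simp only [hsplit, sum_add_distrib]
  have hJ : J + 1 < blen a J := by unfold blen; omega
  rw [sum_ite_eq' (range (blen a J)) (J + 1), if_pos (mem_range.mpr hJ)]
  congr 1
  have hle : a + J + 1 ≤ blen a J := by unfold blen; omega
  rw [← sum_range_add_sum_Ico _ hle]
  rw [sum_eq_zero (s := Ico _ _) fun i hi => by
    rw [mem_Ico] at hi; rw [mcoef_eq_zero (by omega)]; simp, add_zero]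

/-- The scaled factor: `toPolyZ (loListZ …) = 2^S · toPolyQ (loList …)` under the dyadic check. [folklore] -/
theorem toPolyZ_loListZ (a J : ℕ) (eps : ℚ) (S : ℕ)
    (h : (loList a J eps).all (dyadicOK S) = true) :
    toPolyZ (loListZ a J eps S) = C ((2 : ℝ) ^ S) * toPolyQ (loList a J eps) := by
  rw [loListZ]
  exact toPolyZ_map_scaleZ S _ (by simpa [List.all_eq_true] using h)

/-- Semantics lemma `toPolyZ_upListZ` of the SEEDCERT evaluator soundness proof (list-kernel / walk-count layer; see the module docstring). [folklore] -/
theorem toPolyZ_upListZ (a J : ℕ) (eps : ℚ) (S : ℕ)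
    (h : (upList a J eps).all (dyadicOK S) = true) :
    toPolyZ (upListZ a J eps S) = C ((2 : ℝ) ^ S) * toPolyQ (upList a J eps) := by
  rw [upListZ]
  exact toPolyZ_map_scaleZ S _ (by simpa [List.all_eq_true] using h)

end Literature.Probability.FitznerVanDerHofstad2017.SeedCert


namespace Literature.Probability.FitznerVanDerHofstad2017.SeedCert

open Finset
open scoped Nat
open SrwCount (walk1 coordD G G_succ G_zero walk1_closed walk1_eq_zero_off)
open Literature.Probability.FitznerVanDerHofstad2017.SrwCount (walk1_closed walk1_eq_zero_off)

/-! ### The walk-count layer: list kernels -/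

/-- Semantics lemma `factorial_mul_prodRangeAux` of the SEEDCERT evaluator soundness proof (list-kernel / walk-count layer; see the module docstring). [folklore] -/
theorem factorial_mul_prodRangeAux : ∀ (n i acc : ℕ), i ! * prodRangeAux n i acc = acc * (i + n)!
  | 0, i, acc => by simp [prodRangeAux, mul_comm]
  | n + 1, i, acc => by
      rw [prodRangeAux]
      have ih := factorial_mul_prodRangeAux n (i + 1) (acc * (i + 1))
      apply Nat.eq_of_mul_eq_mul_left (Nat.succ_pos i)
      calc (i + 1) * (i ! * prodRangeAux n (i + 1) (acc * (i + 1)))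
          = (i + 1)! * prodRangeAux n (i + 1) (acc * (i + 1)) := by rw [Nat.factorial_succ]; ring
        _ = acc * (i + 1) * (i + 1 + n)! := ih
        _ = (i + 1) * (acc * (i + (n + 1))!) := by rw [show i + 1 + n = i + (n + 1) by ring]; ring

/-- Semantics lemma `prodRange_zero` of the SEEDCERT evaluator soundness proof (list-kernel / walk-count layer; see the module docstring). [folklore] -/
theorem prodRange_zero (b : ℕ) : prodRange 0 b = b ! := by
  have h := factorial_mul_prodRangeAux b 0 1
  simpa [prodRange] using h

/-- The ratio recursion of `hatRow1Aux` reproduces `Mf / (k! (k+a)!)`. [folklore] -/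
theorem hatRow1Aux_getD (Mf a : ℕ) : ∀ (n k i : ℕ), i < n →
    (hatRow1Aux a n k (Mf / (k ! * (k + a)!))).getD i 0 = Mf / ((k + i)! * (k + i + a)!)
  | 0, k, i, h => by omega
  | n + 1, k, 0, _ => by simp [hatRow1Aux]
  | n + 1, k, i + 1, h => by
      rw [hatRow1Aux, List.getD_cons_succ]
      have hrec : Mf / (k ! * (k + a)!) / ((k + 1) * (k + 1 + a)) = Mf / ((k + 1)! * (k + 1 + a)!) := by
        rw [Nat.div_div_eq_div_mul]
        congr 1
        rw [show k + 1 + a = (k + a) + 1 by ring, Nat.factorial_succ, Nat.factorial_succ]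
        ring
      rw [hrec, hatRow1Aux_getD Mf a n (k + 1) i (by omega)]
      congr 2 <;> ring_nf

/-- Semantics lemma `length_hatRow1Aux` of the SEEDCERT evaluator soundness proof (list-kernel / walk-count layer; see the module docstring). [folklore] -/
theorem length_hatRow1Aux (a : ℕ) : ∀ (n k c : ℕ), (hatRow1Aux a n k c).length = n
  | 0, k, c => rfl
  | n + 1, k, c => by simp [hatRow1Aux, length_hatRow1Aux a n]

/-- Semantics lemma `hatRow1_getD` of the SEEDCERT evaluator soundness proof (list-kernel / walk-count layer; see the module docstring). [folklore] -/
theorem hatRow1_getD (Mf a K i : ℕ) (hi : i ≤ K) :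
    (hatRow1 Mf a K).getD i 0 = Mf / (i ! * (i + a)!) := by
  rw [hatRow1, prodRange_zero]
  have h0 : Mf / a ! = Mf / ((0 : ℕ)! * (0 + a)!) := by simp
  rw [h0, hatRow1Aux_getD Mf a (K + 1) 0 i (by omega)]
  simp

/-- Semantics lemma `length_hatRow1` of the SEEDCERT evaluator soundness proof (list-kernel / walk-count layer; see the module docstring). [folklore] -/
theorem length_hatRow1 (Mf a K : ℕ) : (hatRow1 Mf a K).length = K + 1 := by
  rw [hatRow1, length_hatRow1Aux]

/-! #### The truncated Cauchy product -/

/-- Semantics lemma `getD_zipAddN` of the SEEDCERT evaluator soundness proof (list-kernel / walk-count layer; see the module docstring). [folklore] -/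
theorem getD_zipAddN : ∀ (a b : List ℕ) (k : ℕ), (zipAddN a b).getD k 0 = a.getD k 0 + b.getD k 0
  | [], b, k => by simp [zipAddN]
  | x :: xs, [], k => by simp [zipAddN]
  | x :: xs, y :: ys, 0 => by simp [zipAddN]
  | x :: xs, y :: ys, k + 1 => by
      simp only [zipAddN, List.getD_cons_succ]; exact getD_zipAddN xs ys k

/-- Semantics lemma `mulRowN_nil` of the SEEDCERT evaluator soundness proof (list-kernel / walk-count layer; see the module docstring). [folklore] -/
theorem mulRowN_nil (c : ℕ) : ∀ L : ℕ, mulRowN c [] L = []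
  | 0 => rfl
  | _ + 1 => rfl

/-- Semantics lemma `getD_mulRowN` of the SEEDCERT evaluator soundness proof (list-kernel / walk-count layer; see the module docstring). [folklore] -/
theorem getD_mulRowN (c : ℕ) : ∀ (v : List ℕ) (L k : ℕ),
    (mulRowN c v L).getD k 0 = if k < L then c * v.getD k 0 else 0
  | v, 0, k => by cases v <;> simp [mulRowN]
  | [], L + 1, k => by simp [mulRowN]
  | x :: xs, L + 1, 0 => by simp [mulRowN]
  | x :: xs, L + 1, k + 1 => by
      simp only [mulRowN, List.getD_cons_succ, getD_mulRowN c xs L k, Nat.succ_lt_succ_iff]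

/-- Semantics lemma `length_mulRowN` of the SEEDCERT evaluator soundness proof (list-kernel / walk-count layer; see the module docstring). [folklore] -/
theorem length_mulRowN (c : ℕ) : ∀ (v : List ℕ) (L : ℕ), (mulRowN c v L).length = min L v.length
  | v, 0 => by cases v <;> simp [mulRowN]
  | [], L + 1 => by simp [mulRowN]
  | x :: xs, L + 1 => by simp [mulRowN, length_mulRowN c xs L, Nat.succ_min_succ]

/-- Coefficient `k < L` of the truncated product is the Cauchy coefficient. [folklore] -/
theorem getD_convN : ∀ (u v : List ℕ) (L k : ℕ), v ≠ [] → k < L →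
    (convN u v L).getD k 0 = ∑ i ∈ range (k + 1), u.getD i 0 * v.getD (k - i) 0
  | [], v, L, k, _, hk => by
      simp [convN, List.getD_eq_getElem?_getD, hk]
  | c :: us, v, 0, k, _, hk => by omega
  | c :: us, v, L + 1, k, hv, hk => by
      rw [convN]
      have hne : mulRowN c v (L + 1) ≠ [] := by
        intro h
        have := congrArg List.length h
        rw [length_mulRowN] at this
        cases v with
        | nil => exact hv rfl
        | cons y ys => simp at this
      obtain ⟨p, ps, hp⟩ : ∃ p ps, mulRowN c v (L + 1) = p :: ps := by
        cases h : mulRowN c v (L + 1) with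
        | nil => exact absurd h hne
        | cons p ps => exact ⟨p, ps, rfl⟩
      rw [hp]
      simp only
      cases k with
      | zero =>
          have h0 := getD_mulRowN c v (L + 1) 0
          rw [hp, List.getD_cons_zero, if_pos (by omega)] at h0
          simp [h0]
      | succ k =>
          rw [List.getD_cons_succ, getD_zipAddN, getD_convN us v L k hv (by omega)]
          have h1 := getD_mulRowN c v (L + 1) (k + 1)
          rw [hp, List.getD_cons_succ, if_pos hk] at h1
          rw [h1, sum_range_succ' _ (k + 1)]
          simp only [List.getD_cons_succ, List.getD_cons_zero, Nat.sub_zero, Nat.succ_sub_succ]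
          rw [add_comm]

/-- Semantics lemma `length_convN` of the SEEDCERT evaluator soundness proof (list-kernel / walk-count layer; see the module docstring). [folklore] -/
theorem length_convN : ∀ (u v : List ℕ) (L : ℕ), v ≠ [] → (convN u v L).length = L
  | [], v, L, _ => by simp [convN]
  | c :: us, v, 0, _ => by simp [convN]
  | c :: us, v, L + 1, hv => by
      rw [convN]
      have hlen := length_mulRowN c v (L + 1)
      cases h : mulRowN c v (L + 1) with
      | nil =>
          rw [h] at hlen
          cases v with
          | nil => exact absurd rfl hv
          | cons y ys => simp at hlen
      | cons p ps =>
          rw [h] at hlen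
          simp only [List.length_cons, length_zipAddN, length_convN us v L hv]
          simp at hlen
          omega

/-- Semantics lemma `getD_divRow` of the SEEDCERT evaluator soundness proof (list-kernel / walk-count layer; see the module docstring). [folklore] -/
theorem getD_divRow (Mf : ℕ) : ∀ (l : List ℕ) (k : ℕ), (divRow Mf l).getD k 0 = l.getD k 0 / Mf
  | [], k => by simp [divRow]
  | x :: xs, 0 => by simp [divRow]
  | x :: xs, k + 1 => by simp only [divRow, List.getD_cons_succ]; exact getD_divRow Mf xs k

/-- Semantics lemma `length_divRow` of the SEEDCERT evaluator soundness proof (list-kernel / walk-count layer; see the module docstring). [folklore] -/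
theorem length_divRow (Mf : ℕ) : ∀ l : List ℕ, (divRow Mf l).length = l.length
  | [] => rfl
  | x :: xs => by simp [divRow, length_divRow Mf xs]

/-! ### The walk counts `G` on the parity lattice -/

section Walks

variable {d : ℕ} (x : Fin d → ℤ) (cs : List ℕ)

/-- `A_j = Σ_{i<j} cs_i`. [folklore] -/
def Asum (j : ℕ) : ℕ := (cs.take j).sum

/-- Semantics lemma `Asum_succ` of the SEEDCERT evaluator soundness proof (list-kernel / walk-count layer; see the module docstring). [folklore] -/
theorem Asum_succ (j : ℕ) : Asum cs (j + 1) = Asum cs j + cs.getD j 0 := by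
  unfold Asum
  rcases lt_or_ge j cs.length with h | h
  · rw [List.take_add_one, List.sum_append]
    simp [List.getD_eq_getElem?_getD, List.getElem?_eq_getElem h]
  · rw [List.take_of_length_le h, List.take_of_length_le (by omega)]
    simp [List.getD_eq_getElem?_getD, List.getElem?_eq_none (by omega : cs.length ≤ j)]

variable {x cs}

/-- **Parity/min-length support of the walk counts**: `G x j m ≠ 0 ⟹ m = 2i + A_j`. [folklore] -/
theorem G_support (hcs : ∀ i, coordD x i = ((cs.getD i 0 : ℕ) : ℤ)) :
    ∀ (j m : ℕ), G x j m ≠ 0 → ∃ i, m = 2 * i + Asum cs j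
  | 0, m, h => by
      refine ⟨0, ?_⟩
      have hm : m = 0 := by
        by_contra hm; exact h (by simp [hm])
      subst hm; simp [Asum]
  | j + 1, m, h => by
      rw [G_succ] at h
      obtain ⟨ij, hij, hne⟩ := exists_ne_zero_of_sum_ne_zero h
      rw [mem_antidiagonal] at hij
      have hw : walk1 ij.1 (coordD x j) ≠ 0 := fun h0 => hne (by simp [h0])
      have hg : G x j ij.2 ≠ 0 := fun h0 => hne (by simp [h0])
      obtain ⟨i₂, hi₂⟩ := G_support hcs j ij.2 hg
      have hw' : ∃ i₁, ij.1 = 2 * i₁ + cs.getD j 0 := by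
        by_contra hcon
        push Not at hcon
        apply hw
        rw [hcs j]
        exact walk1_eq_zero_off _ _ (by simpa using hcon)
      obtain ⟨i₁, hi₁⟩ := hw'
      exact ⟨i₁ + i₂, by rw [Asum_succ]; omega⟩

/-- Semantics lemma `G_eq_zero_of_not_support` of the SEEDCERT evaluator soundness proof (list-kernel / walk-count layer; see the module docstring). [folklore] -/
theorem G_eq_zero_of_not_support (hcs : ∀ i, coordD x i = ((cs.getD i 0 : ℕ) : ℤ)) (j m : ℕ)
    (h : ∀ i, m ≠ 2 * i + Asum cs j) : G x j m = 0 := by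
  by_contra hne
  obtain ⟨i, hi⟩ := G_support hcs j m hne
  exact h i hi

/-- **The EGF step of the dimension recursion on the parity lattice** (in `ℚ`):
`Σ_{i ≤ k} [Mf/(i!(i+b)!)]·[Mf G_j(2(k-i)+A_j)/(2(k-i)+A_j)!] = Mf² G_{j+1}(2k+A_{j+1})/(2k+A_{j+1})!`
with `b = cs_j`. [folklore] -/
theorem hat_step_identity (hcs : ∀ i, coordD x i = ((cs.getD i 0 : ℕ) : ℤ)) (Mf j k : ℕ) :
    ∑ i ∈ range (k + 1), (Mf : ℚ) / ((i ! : ℚ) * ((i + cs.getD j 0)! : ℚ))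
        * ((Mf : ℚ) * (G x j (2 * (k - i) + Asum cs j) : ℚ) / ((2 * (k - i) + Asum cs j)! : ℚ))
      = (Mf : ℚ) * ((Mf : ℚ) * (G x (j + 1) (2 * k + Asum cs (j + 1)) : ℚ)
          / ((2 * k + Asum cs (j + 1))! : ℚ)) := by
  set b := cs.getD j 0 with hb
  set A := Asum cs j with hA
  set m := 2 * k + Asum cs (j + 1) with hm
  have hmA : m = 2 * k + A + b := by rw [hm, Asum_succ]; omega
  -- expand `G_{j+1}` and pass to a `range` sum
  rw [G_succ, Finset.Nat.sum_antidiagonal_eq_sum_range_succ_mk, hcs j]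
  dsimp only
  rw [Nat.cast_sum]
  -- the summand vanishes off `ℓ = 2i + b`, `i ≤ k`
  have hvan : ∀ ℓ ∈ range m.succ, ℓ ∉ (range (k + 1)).image (fun i => 2 * i + b) →
      ((m.choose ℓ * (walk1 ℓ ((b : ℕ) : ℤ) * G x j (m - ℓ)) : ℕ) : ℚ) = 0 := by
    intro ℓ hℓ hnot
    rw [mem_range] at hℓ
    by_cases hform : ∃ i, ℓ = 2 * i + b
    · obtain ⟨i, rfl⟩ := hform
      have hik : k < i := by
        by_contra hle
        exact hnot (mem_image.mpr ⟨i, mem_range.mpr (by omega), rfl⟩)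
      have hG : G x j (m - (2 * i + b)) = 0 :=
        G_eq_zero_of_not_support hcs j _ fun i' => by omega
      simp [hG]
    · push Not at hform
      have hw : walk1 ℓ ((b : ℕ) : ℤ) = 0 :=
        walk1_eq_zero_off _ _ (fun i => by simpa using hform i)
      simp [hw]
  have hsub : (range (k + 1)).image (fun i => 2 * i + b) ⊆ range m.succ := by
    intro ℓ hℓ
    obtain ⟨i, hi, rfl⟩ := mem_image.mp hℓ
    rw [mem_range] at hi ⊢
    omega
  have hinj : Set.InjOn (fun i => 2 * i + b) ↑(range (k + 1)) := by
    intro i _ i' _ h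
    simp only at h
    omega
  rw [← sum_subset hsub hvan, sum_image hinj]
  simp only [Finset.mul_sum, Finset.sum_div]
  refine sum_congr rfl fun i hi => ?_
  rw [mem_range] at hi
  have hℓm : 2 * i + b ≤ m := by omega
  have hr : m - (2 * i + b) = 2 * (k - i) + A := by omega
  rw [walk1_closed (2 * i + b) i b (by ring), hr]
  have h1 : ((m.choose (2 * i + b) : ℕ) : ℚ)
      = (m ! : ℚ) / (((2 * i + b) ! : ℚ) * ((m - (2 * i + b))! : ℚ)) := by
    rw [eq_div_iff (by positivity), ← mul_assoc]
    exact_mod_cast Nat.choose_mul_factorial_mul_factorial hℓm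
  have h2 : (((2 * i + b).choose i : ℕ) : ℚ) = ((2 * i + b) ! : ℚ) / ((i ! : ℚ) * ((i + b)! : ℚ)) := by
    rw [eq_div_iff (by positivity), ← mul_assoc]
    have := Nat.choose_mul_factorial_mul_factorial (show i ≤ 2 * i + b by omega)
    rw [show 2 * i + b - i = i + b by omega] at this
    exact_mod_cast this
  push_cast
  rw [h1, h2, hr]
  field_simp

end Walks

end Literature.Probability.FitznerVanDerHofstad2017.SeedCert


namespace Literature.Probability.FitznerVanDerHofstad2017.SeedCert

open Finset
open scoped Nat
open SrwCount (walk1 coordD G G_succ G_zero srwCount srwLaw_eq_srwCount_div)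
open Literature.Barriers.CriticalPhenomena.LongRangePhi4 (srwLaw)
open Literature.Probability.FitznerVanDerHofstad2017.SrwCount (walk1_closed walk1_eq_zero_off)

section HatFold

variable {d : ℕ} {x : Fin d → ℤ} {cs : List ℕ}

/-- The hat-table invariant at level `j`: length `K+1` and
`Ŵ_k = Mf · G_j(2k + A_j)/(2k + A_j)!` (as rationals; the division is exact). [folklore] -/
def HatInv (x : Fin d → ℤ) (cs : List ℕ) (Mf K : ℕ) (row : List ℕ) (j : ℕ) : Prop :=
  row.length = K + 1 ∧ ∀ k ≤ K, ((row.getD k 0 : ℕ) : ℚ)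
    = (Mf : ℚ) * (G x j (2 * k + Asum cs j) : ℚ) / ((2 * k + Asum cs j)! : ℚ)

/-- Semantics lemma `hatInv_delta0` of the SEEDCERT evaluator soundness proof (list-kernel / walk-count layer; see the module docstring). [folklore] -/
theorem hatInv_delta0 (x : Fin d → ℤ) (cs : List ℕ) (Mf K : ℕ) :
    HatInv x cs Mf K (delta0 Mf K) 0 := by
  refine ⟨by simp [delta0], fun k hk => ?_⟩
  cases k with
  | zero => simp [delta0, Asum]
  | succ k =>
      have h1 : (delta0 Mf K).getD (k + 1) 0 = 0 := by
        rw [delta0, List.getD_cons_succ, List.getD_eq_getElem?_getD, List.getElem?_replicate]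
        split <;> rfl
      rw [h1]
      simp [Asum]

/-- Semantics lemma `Asum_le_sum` of the SEEDCERT evaluator soundness proof (list-kernel / walk-count layer; see the module docstring). [folklore] -/
theorem Asum_le_sum (cs : List ℕ) (j : ℕ) : Asum cs j ≤ cs.sum := by
  have := List.sum_take_add_sum_drop cs j
  unfold Asum; omega

/-- One coordinate step preserves the hat invariant. [folklore] -/
theorem hatInv_step (hcs : ∀ i, coordD x i = ((cs.getD i 0 : ℕ) : ℤ)) {Mf Mh K : ℕ}
    (hMf : Mf = Mh !) {row : List ℕ} {j : ℕ} (hrow : HatInv x cs Mf K row j)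
    (hK : 2 * K + Asum cs (j + 1) ≤ Mh) :
    HatInv x cs Mf K (hatStep Mf K row (cs.getD j 0)) (j + 1) := by
  obtain ⟨hlen, hval⟩ := hrow
  have hne : row ≠ [] := by intro h; rw [h] at hlen; simp at hlen
  have hMfpos : 0 < Mf := by rw [hMf]; exact Nat.factorial_pos _
  have hAj : Asum cs (j + 1) = Asum cs j + cs.getD j 0 := Asum_succ cs j
  refine ⟨?_, fun k hk => ?_⟩
  · rw [hatStep, forceN_eq, length_divRow, length_convN _ _ _ hne]
  · rw [hatStep, forceN_eq, getD_divRow, getD_convN _ _ _ _ hne (by omega)]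
    -- the numerator in ℚ
    have hnum : ((∑ i ∈ range (k + 1), (hatRow1 Mf (cs.getD j 0) K).getD i 0 * row.getD (k - i) 0 : ℕ) : ℚ)
        = (Mf : ℚ) * ((Mf : ℚ) * (G x (j + 1) (2 * k + Asum cs (j + 1)) : ℚ)
            / ((2 * k + Asum cs (j + 1))! : ℚ)) := by
      rw [← hat_step_identity hcs Mf j k]
      push_cast
      refine sum_congr rfl fun i hi => ?_
      rw [mem_range] at hi
      rw [hatRow1_getD Mf (cs.getD j 0) K i (by omega), hval (k - i) (by omega)]
      have hdvd : i ! * (i + cs.getD j 0)! ∣ Mf := by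
        rw [hMf]
        exact (Nat.factorial_mul_factorial_dvd_factorial_add i (i + cs.getD j 0)).trans
          (Nat.factorial_dvd_factorial (by omega))
      rw [Nat.cast_div hdvd (by positivity)]
      push_cast
      ring
    -- exactness of the division by `Mf`
    have hmdvd : (2 * k + Asum cs (j + 1))! ∣ Mf := by
      rw [hMf]; exact Nat.factorial_dvd_factorial (by omega)
    obtain ⟨q, hq⟩ := hmdvd
    have hm0 : (((2 * k + Asum cs (j + 1))! : ℕ) : ℚ) ≠ 0 := by positivity
    have hMfq : (Mf : ℚ) = (((2 * k + Asum cs (j + 1))! : ℕ) : ℚ) * (q : ℚ) := by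
      rw [hq]; push_cast; ring
    have hS : (∑ i ∈ range (k + 1), (hatRow1 Mf (cs.getD j 0) K).getD i 0 * row.getD (k - i) 0)
        = Mf * (q * G x (j + 1) (2 * k + Asum cs (j + 1))) := by
      have h' : ((∑ i ∈ range (k + 1),
            (hatRow1 Mf (cs.getD j 0) K).getD i 0 * row.getD (k - i) 0 : ℕ) : ℚ)
          = ((Mf * (q * G x (j + 1) (2 * k + Asum cs (j + 1))) : ℕ) : ℚ) := by
        rw [hnum]
        push_cast
        congr 1
        rw [hMfq, mul_assoc, mul_div_cancel_left₀ _ hm0]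
      exact_mod_cast h'
    rw [hS, Nat.mul_div_cancel_left _ hMfpos]
    push_cast
    rw [hMfq, mul_assoc, mul_div_cancel_left₀ _ hm0]

/-- The fold over the coordinates maintains the invariant. [folklore] -/
theorem hatInv_foldl (hcs : ∀ i, coordD x i = ((cs.getD i 0 : ℕ) : ℤ)) {Mf Mh K : ℕ}
    (hMf : Mf = Mh !) (hK : 2 * K + cs.sum ≤ Mh) :
    ∀ j, j ≤ cs.length → HatInv x cs Mf K ((cs.take j).foldl (hatStep Mf K) (delta0 Mf K)) j
  | 0, _ => by simpa using hatInv_delta0 x cs Mf K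
  | j + 1, hj => by
      have ih := hatInv_foldl hcs hMf hK j (by omega)
      have htake : cs.take (j + 1) = cs.take j ++ [cs.getD j 0] := by
        rw [List.take_add_one]
        congr 1
        simp [List.getElem?_eq_getElem (by omega : j < cs.length), List.getD_eq_getElem?_getD]
      rw [htake, List.foldl_append, List.foldl_cons, List.foldl_nil]
      exact hatInv_step hcs hMf ih (by have := Asum_le_sum cs (j + 1); omega)

/-- Semantics lemma `Asum_length` of the SEEDCERT evaluator soundness proof (list-kernel / walk-count layer; see the module docstring). [folklore] -/
theorem Asum_length (cs : List ℕ) : Asum cs cs.length = cs.sum := by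
  simp [Asum]

/-- **Hat-table semantics**: `Ŵ_k = M̂! · G_d(2k + A)/(2k + A)!` for the full fold. [folklore] -/
theorem wHatFold_spec (hcs : ∀ i, coordD x i = ((cs.getD i 0 : ℕ) : ℤ)) {Mh K : ℕ}
    (hK : 2 * K + cs.sum ≤ Mh) :
    (wHatFold (prodRange 0 Mh) K cs).length = K + 1 ∧
      ∀ k ≤ K, (((wHatFold (prodRange 0 Mh) K cs).getD k 0 : ℕ) : ℚ)
        = (Mh ! : ℚ) * (G x cs.length (2 * k + cs.sum) : ℚ) / ((2 * k + cs.sum)! : ℚ) := by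
  unfold wHatFold
  have h := hatInv_foldl hcs (prodRange_zero Mh) hK cs.length le_rfl
  rw [List.take_length] at h
  obtain ⟨hlen, hval⟩ := h
  refine ⟨hlen, fun k hk => ?_⟩
  rw [hval k hk, Asum_length, prodRange_zero]

end HatFold

/-! ### Horner and the factorial / exponential sequences -/

/-- Semantics lemma `hornerAux_eq` of the SEEDCERT evaluator soundness proof (list-kernel / walk-count layer; see the module docstring). [folklore] -/
theorem hornerAux_eq : ∀ (w f : List ℕ) (acc : ℕ), f.length ≤ w.length →
    hornerAux w f acc = acc * 484 ^ f.length
      + ∑ i ∈ range f.length, w.getD i 0 * f.getD i 0 * 484 ^ (f.length - 1 - i)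
  | [], [], acc, _ => by simp [hornerAux]
  | _ :: _, [], acc, _ => by simp [hornerAux]
  | [], f :: fs, acc, h => by simp at h
  | w :: ws, f :: fs, acc, h => by
      rw [hornerAux, hornerAux_eq ws fs _ (by simpa using h)]
      simp only [List.length_cons]
      rw [sum_range_succ']
      simp only [List.getD_cons_succ, List.getD_cons_zero]
      have e1 : ∀ i, fs.length + 1 - 1 - (i + 1) = fs.length - 1 - i := by intro i; omega
      simp only [e1, show fs.length + 1 - 1 - 0 = fs.length by omega, pow_succ]
      ring

/-- Semantics lemma `facSeqAux_getD` of the SEEDCERT evaluator soundness proof (list-kernel / walk-count layer; see the module docstring). [folklore] -/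
theorem facSeqAux_getD : ∀ (c j i : ℕ), i < c → (facSeqAux j (j !) c).getD i 0 = (j + 2 * i)!
  | 0, j, i, h => by omega
  | c + 1, j, 0, _ => by simp [facSeqAux]
  | c + 1, j, i + 1, h => by
      rw [facSeqAux, List.getD_cons_succ]
      have e : j ! * ((j + 1) * (j + 2)) = (j + 2)! := by
        rw [Nat.factorial_succ (j + 1), Nat.factorial_succ j]; ring
      rw [e, facSeqAux_getD c (j + 2) i (by omega)]
      congr 1; ring

/-- Semantics lemma `length_facSeqAux` of the SEEDCERT evaluator soundness proof (list-kernel / walk-count layer; see the module docstring). [folklore] -/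
theorem length_facSeqAux : ∀ (c j f : ℕ), (facSeqAux j f c).length = c
  | 0, j, f => by simp [facSeqAux]
  | c + 1, j, f => by simp [facSeqAux, length_facSeqAux c]

/-- Semantics lemma `facSeq_getD` of the SEEDCERT evaluator soundness proof (list-kernel / walk-count layer; see the module docstring). [folklore] -/
theorem facSeq_getD (s c i : ℕ) (h : i < c) : (facSeq s c).getD i 0 = (s + 2 * i)! :=
  facSeqAux_getD c s i h

/-- Semantics lemma `length_facSeq` of the SEEDCERT evaluator soundness proof (list-kernel / walk-count layer; see the module docstring). [folklore] -/
theorem length_facSeq (s c : ℕ) : (facSeq s c).length = c := length_facSeqAux c s _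

/-- `E_k(λ) = Σ_{i<k} λ^i/i!` over `ℚ`. [folklore] -/
def EQ (lam k : ℕ) : ℚ := ∑ i ∈ range k, (lam : ℚ) ^ i / (i ! : ℚ)

/-- The state invariant of `expStepAux`: `a = j! · E_{j+1}(λ)`, `p = λ^j`. [folklore] -/
def ExpInv (lam j a p : ℕ) : Prop := (a : ℚ) = (j ! : ℚ) * EQ lam (j + 1) ∧ p = lam ^ j

/-- Semantics lemma `expInv_zero` of the SEEDCERT evaluator soundness proof (list-kernel / walk-count layer; see the module docstring). [folklore] -/
theorem expInv_zero (lam : ℕ) : ExpInv lam 0 1 1 := by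
  simp [ExpInv, EQ]

/-- Semantics lemma `expInv_succ` of the SEEDCERT evaluator soundness proof (list-kernel / walk-count layer; see the module docstring). [folklore] -/
theorem expInv_succ {lam j a p : ℕ} (h : ExpInv lam j a p) :
    ExpInv lam (j + 1) ((j + 1) * a + p * lam) (p * lam) := by
  obtain ⟨ha, hp⟩ := h
  refine ⟨?_, by rw [hp, pow_succ]⟩
  push_cast
  rw [ha, hp, EQ, EQ, sum_range_succ _ (j + 1), Nat.factorial_succ]
  push_cast
  field_simp
  ring

/-- Semantics lemma `expStepAux_inv` of the SEEDCERT evaluator soundness proof (list-kernel / walk-count layer; see the module docstring). [folklore] -/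
theorem expStepAux_inv (lam : ℕ) : ∀ (s j a p : ℕ), ExpInv lam j a p →
    ExpInv lam (j + s) (expStepAux lam j a p s).1 (expStepAux lam j a p s).2
  | 0, j, a, p, h => by simpa [expStepAux] using h
  | s + 1, j, a, p, h => by
      rw [expStepAux, show j + (s + 1) = j + 1 + s by ring]
      exact expStepAux_inv lam s (j + 1) _ _ (expInv_succ h)

/-- Semantics lemma `expSeqAux_getD` of the SEEDCERT evaluator soundness proof (list-kernel / walk-count layer; see the module docstring). [folklore] -/
theorem expSeqAux_getD (lam : ℕ) : ∀ (c j a p i : ℕ), ExpInv lam j a p → i < c →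
    (((expSeqAux lam j a p c).getD i 0 : ℕ) : ℚ) = ((j + 2 * i)! : ℚ) * EQ lam (j + 2 * i + 1)
  | 0, _, _, _, _, _, h => by omega
  | c + 1, j, a, p, 0, hinv, _ => by simpa [expSeqAux] using hinv.1
  | c + 1, j, a, p, i + 1, hinv, h => by
      simp only [expSeqAux, List.getD_cons_succ]
      rw [expSeqAux_getD lam c (j + 2) _ _ i (expStepAux_inv lam 2 j a p hinv) (by omega)]
      congr 2 <;> ring_nf

/-- Semantics lemma `length_expSeqAux` of the SEEDCERT evaluator soundness proof (list-kernel / walk-count layer; see the module docstring). [folklore] -/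
theorem length_expSeqAux (lam : ℕ) : ∀ (c j a p : ℕ), (expSeqAux lam j a p c).length = c
  | 0, j, a, p => by simp [expSeqAux]
  | c + 1, j, a, p => by simp [expSeqAux, length_expSeqAux lam c]

/-- Semantics lemma `expSeq_getD` of the SEEDCERT evaluator soundness proof (list-kernel / walk-count layer; see the module docstring). [folklore] -/
theorem expSeq_getD (lam s c i : ℕ) (h : i < c) :
    (((expSeq lam s c).getD i 0 : ℕ) : ℚ) = ((s + 2 * i)! : ℚ) * EQ lam (s + 2 * i + 1) := by
  have h0 := expStepAux_inv lam s 0 1 1 (expInv_zero lam)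
  rw [zero_add] at h0
  exact expSeqAux_getD lam c s _ _ i h0 h

/-- Semantics lemma `length_expSeq` of the SEEDCERT evaluator soundness proof (list-kernel / walk-count layer; see the module docstring). [folklore] -/
theorem length_expSeq (lam s c : ℕ) : (expSeq lam s c).length = c := length_expSeqAux lam c s _ _

/-! ### Reindexing over the parity lattice -/

section Parity

variable {d : ℕ} {x : Fin d → ℤ} {cs : List ℕ}

/-- `Σ_{m<M} G_j(m) φ(m) = Σ_{i<(M+1-A_j)/2} G_j(2i+A_j) φ(2i+A_j)`. [folklore] -/
theorem sum_range_parity (hcs : ∀ i, coordD x i = ((cs.getD i 0 : ℕ) : ℤ)) (j M : ℕ)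
    (g : ℕ → ℚ) :
    ∑ m ∈ range M, (G x j m : ℚ) * g m
      = ∑ i ∈ range ((M + 1 - Asum cs j) / 2),
          (G x j (2 * i + Asum cs j) : ℚ) * g (2 * i + Asum cs j) := by
  have hsub : (range ((M + 1 - Asum cs j) / 2)).image (fun i => 2 * i + Asum cs j) ⊆ range M := by
    intro m hm
    obtain ⟨i, hi, rfl⟩ := mem_image.mp hm
    rw [mem_range] at hi ⊢
    omega
  have hinj : Set.InjOn (fun i => 2 * i + Asum cs j) ↑(range ((M + 1 - Asum cs j) / 2)) := by
    intro i _ i' _ h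
    simp only at h
    omega
  have hvan : ∀ m ∈ range M, m ∉ (range ((M + 1 - Asum cs j) / 2)).image
      (fun i => 2 * i + Asum cs j) → (G x j m : ℚ) * g m = 0 := by
    intro m hm hnot
    rw [mem_range] at hm
    have hG : G x j m = 0 := by
      refine G_eq_zero_of_not_support hcs j m fun i hi => hnot ?_
      exact mem_image.mpr ⟨i, mem_range.mpr (by omega), hi.symm⟩
    simp [hG]
  rw [← sum_subset hsub hvan, sum_image hinj]

end Parity

/-! ### `P_n` and `U_n` are the truncated walk sums -/

namespace Cert

variable (c : Cert)

/-- The facts packed in `paramsOK`. [folklore] -/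
structure Params : Prop where
  s0_pos : 0 < c.s0
  s0_lt : c.s0 < 1
  hT : ((c.J : ℚ) + 3 / 2) / (2 * c.s0 ^ 2) ≤ (c.t : ℚ) ^ 2
  t_pos : 0 < c.t
  hMh : c.Mh = 2 * c.K + c.A
  hlen : c.coords.length ≤ 11
  nexp_pos : 0 < c.nexp
  sLo_pos : 0 < c.sLo
  sLo_sq : c.sLo ^ 2 ≤ 2 * piLo
  sHi_pos : 0 < c.sHi
  sHi_sq : 2 * piHi ≤ c.sHi ^ 2
  eLo_nonneg : 0 ≤ expNegOneLo
  eps_nonneg : ∀ a ∈ c.avals, 0 ≤ c.eps a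
  eps_ge : ∀ a ∈ c.avals, epsBoundQ a c.J c.s0 c.t c.sHi c.nexp ≤ c.eps a
  floor_nonneg : ∀ a ∈ c.avals, 0 ≤ loFloor a c.J (c.eps a) c.h
  lo_dy : ∀ a ∈ c.avals, ∀ q ∈ loList a c.J (c.eps a), dyadicOK c.S q = true
  up_dy : ∀ a ∈ c.avals, ∀ q ∈ upList a c.J (c.eps a), dyadicOK c.S q = true
  M_pos : ∀ n, 1 ≤ n → n ≤ 4 → 1 ≤ c.M n
  M_le : ∀ n, 1 ≤ n → n ≤ 4 → c.M n ≤ c.Mh + 1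
  cnt_le : ∀ n, 1 ≤ n → n ≤ 4 → c.cnt n ≤ c.K + 1
  lam_lt : ∀ n, 1 ≤ n → n ≤ 4 → c.lam + 1 < c.M n

/-- Semantics lemma `params_of_paramsOK` of the SEEDCERT evaluator soundness proof (list-kernel / walk-count layer; see the module docstring). [folklore] -/
theorem params_of_paramsOK (h : c.paramsOK = true) : c.Params := by
  simp only [paramsOK, Bool.and_eq_true, decide_eq_true_eq, List.all_eq_true, beq_iff_eq,
    List.mem_range] at h
  obtain ⟨⟨⟨⟨⟨⟨⟨⟨⟨⟨⟨⟨⟨h1, h2⟩, h3⟩, h4⟩, h5⟩, h6⟩, h7⟩, h8⟩, h9⟩, h10⟩, h11⟩, h12⟩, h13⟩, h14⟩ := h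
  have hn : ∀ n, 1 ≤ n → n ≤ 4 → 1 ≤ c.M n ∧ c.M n ≤ c.Mh + 1 ∧ c.cnt n ≤ c.K + 1 ∧ c.lam + 1 < c.M n := by
    intro n hn1 hn4
    obtain ⟨⟨⟨a1, a2⟩, a3⟩, a4⟩ := h14 (n - 1) (by omega)
    rw [show n - 1 + 1 = n by omega] at a1 a2 a3 a4
    exact ⟨a1, a2, a3, a4⟩
  exact ⟨h1, h2, h3, h4, h5, h6, h7, h8, h9, h10, h11, h12,
    fun a ha => (h13 a ha).1.1.1.1, fun a ha => (h13 a ha).1.1.1.2, fun a ha => (h13 a ha).1.1.2,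
    fun a ha => (h13 a ha).1.2, fun a ha => (h13 a ha).2,
    fun n h1 h4 => (hn n h1 h4).1, fun n h1 h4 => (hn n h1 h4).2.1, fun n h1 h4 => (hn n h1 h4).2.2.1,
    fun n h1 h4 => (hn n h1 h4).2.2.2⟩

/-- Semantics lemma `length_avals` of the SEEDCERT evaluator soundness proof (list-kernel / walk-count layer; see the module docstring). [folklore] -/
theorem length_avals (hp : c.Params) : c.avals.length = 11 := by
  simp [avals]; have := hp.hlen; omega

/-- Semantics lemma `sum_avals` of the SEEDCERT evaluator soundness proof (list-kernel / walk-count layer; see the module docstring). [folklore] -/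
theorem sum_avals : c.avals.sum = c.A := by
  simp [avals, A]

/-- Semantics lemma `getD_avals` of the SEEDCERT evaluator soundness proof (list-kernel / walk-count layer; see the module docstring). [folklore] -/
theorem getD_avals (i : ℕ) : c.avals.getD i 0 = c.coords.getD i 0 := by
  simp only [avals, List.getD_eq_getElem?_getD]
  rcases lt_or_ge i c.coords.length with h | h
  · rw [List.getElem?_append_left h]
  · rw [List.getElem?_append_right h, List.getElem?_eq_none h]
    simp only [List.getElem?_replicate]
    split <;> simp

variable {c}
variable {x : Fin 11 → ℤ}

/-- The hat table of the certificate. [folklore] -/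
theorem what_spec (hp : c.Params) (hcs : ∀ i, coordD x i = ((c.avals.getD i 0 : ℕ) : ℤ)) :
    c.what.length = c.K + 1 ∧ ∀ k ≤ c.K, (((c.what).getD k 0 : ℕ) : ℚ)
      = (c.Mh ! : ℚ) * (G x 11 (2 * k + c.A) : ℚ) / ((2 * k + c.A)! : ℚ) := by
  have h := wHatFold_spec hcs (Mh := c.Mh) (K := c.K) (by rw [sum_avals, hp.hMh])
  rw [length_avals c hp, sum_avals] at h
  exact h

/-- Semantics lemma `Asum_avals_eleven` of the SEEDCERT evaluator soundness proof (list-kernel / walk-count layer; see the module docstring). [folklore] -/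
theorem Asum_avals_eleven (hp : c.Params) : Asum c.avals 11 = c.A := by
  rw [← length_avals c hp, Asum_length, sum_avals]

/-- **`P_n` is the truncated walk sum** `Σ_{m<M n} C(m+n', n') G_11(m)/22^m`. [folklore] -/
theorem Pq_eq (hp : c.Params) (hcs : ∀ i, coordD x i = ((c.avals.getD i 0 : ℕ) : ℤ))
    (n : ℕ) (hn1 : 1 ≤ n) (hn4 : n ≤ 4) :
    c.Pq c.what n = ∑ m ∈ range (c.M n),
      (((m + (n - 1)).choose (n - 1) : ℕ) : ℚ) * (G x 11 m : ℚ) / (22 : ℚ) ^ m := by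
  obtain ⟨hwl, hwv⟩ := what_spec hp hcs
  have hcnt := hp.cnt_le n hn1 hn4
  have hMh := hp.hMh
  rw [Pq, NP, den, horner, hornerAux_eq _ _ _ (by rw [length_facSeq, hwl]; exact hcnt),
    length_facSeq, zero_mul, zero_add, prodRange_zero]
  -- reindex the right-hand side over the parity lattice
  have hre := sum_range_parity hcs 11 (c.M n)
    (fun m => (((m + (n - 1)).choose (n - 1) : ℕ) : ℚ) / (22 : ℚ) ^ m)
  rw [Asum_avals_eleven hp] at hre
  have hrhs : ∑ m ∈ range (c.M n), (((m + (n - 1)).choose (n - 1) : ℕ) : ℚ) * (G x 11 m : ℚ) / (22 : ℚ) ^ m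
      = ∑ m ∈ range (c.M n), (G x 11 m : ℚ)
          * ((((m + (n - 1)).choose (n - 1) : ℕ) : ℚ) / (22 : ℚ) ^ m) := by
    refine sum_congr rfl fun m _ => ?_; ring
  rw [hrhs, hre]
  change _ = ∑ i ∈ range (c.cnt n), _
  rw [Nat.cast_mul, Nat.cast_pow, Nat.cast_sum, Finset.mul_sum, Finset.sum_div]
  refine sum_congr rfl fun i hi => ?_
  rw [mem_range] at hi
  have hiK : i ≤ c.K := by omega
  rw [Nat.cast_mul, Nat.cast_mul, hwv i hiK, facSeq_getD _ _ _ hi]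
  -- `C(m+n', n') = (m+n')!/(m! n'!)`
  have hch : ((((2 * i + c.A) + (n - 1)).choose (n - 1) : ℕ) : ℚ)
      = (((2 * i + c.A) + (n - 1))! : ℚ) / ((((2 * i + c.A))! : ℚ) * (((n - 1))! : ℚ)) := by
    rw [eq_div_iff (by positivity), ← mul_assoc]
    exact_mod_cast Nat.add_choose_mul_factorial_mul_factorial (2 * i + c.A) (n - 1)
  rw [hch, show c.A + (n - 1) + 2 * i = 2 * i + c.A + (n - 1) by ring]
  -- powers: `484^(K+1-cnt) · 484^(cnt-1-i) · 22^(2i+A) = 22^Mh`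
  have hpow : (484 : ℚ) ^ (c.K + 1 - c.cnt n) * (484 : ℚ) ^ (c.cnt n - 1 - i) * (22 : ℚ) ^ (2 * i + c.A)
      = (22 : ℚ) ^ c.Mh := by
    rw [show (484 : ℚ) = 22 ^ 2 by norm_num, ← pow_mul, ← pow_mul, ← pow_add, ← pow_add]
    congr 1; omega
  have h22' : (22 : ℚ) ^ (2 * i + c.A) ≠ 0 := by positivity
  have h484a : (484 : ℚ) ^ (c.K + 1 - c.cnt n) ≠ 0 := by positivity
  have h484b : (484 : ℚ) ^ (c.cnt n - 1 - i) ≠ 0 := by positivity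
  have hf1 : (((2 * i + c.A))! : ℚ) ≠ 0 := by positivity
  have hf2 : (((n - 1))! : ℚ) ≠ 0 := by positivity
  have hf3 : ((c.Mh)! : ℚ) ≠ 0 := by positivity
  push_cast
  rw [← hpow]
  field_simp

/-- **`U_n` is the truncated walk sum** `Σ_{m<M n} C(m+n', n') G_11(m)/22^m · E_{m+n'+1}(λ)`. [folklore] -/
theorem Uq_eq (hp : c.Params) (hcs : ∀ i, coordD x i = ((c.avals.getD i 0 : ℕ) : ℤ))
    (n : ℕ) (hn1 : 1 ≤ n) (hn4 : n ≤ 4) :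
    c.Uq c.what n = ∑ m ∈ range (c.M n),
      (((m + (n - 1)).choose (n - 1) : ℕ) : ℚ) * (G x 11 m : ℚ) / (22 : ℚ) ^ m
        * EQ c.lam (m + (n - 1) + 1) := by
  obtain ⟨hwl, hwv⟩ := what_spec hp hcs
  have hcnt := hp.cnt_le n hn1 hn4
  have hMh := hp.hMh
  rw [Uq, NU, den, horner, hornerAux_eq _ _ _ (by rw [length_expSeq, hwl]; exact hcnt),
    length_expSeq, zero_mul, zero_add, prodRange_zero]
  -- reindex the right-hand side over the parity lattice
  have hre := sum_range_parity hcs 11 (c.M n)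
    (fun m => (((m + (n - 1)).choose (n - 1) : ℕ) : ℚ) / (22 : ℚ) ^ m * EQ c.lam (m + (n - 1) + 1))
  rw [Asum_avals_eleven hp] at hre
  have hrhs : ∑ m ∈ range (c.M n), (((m + (n - 1)).choose (n - 1) : ℕ) : ℚ) * (G x 11 m : ℚ) / (22 : ℚ) ^ m
        * EQ c.lam (m + (n - 1) + 1)
      = ∑ m ∈ range (c.M n), (G x 11 m : ℚ)
          * ((((m + (n - 1)).choose (n - 1) : ℕ) : ℚ) / (22 : ℚ) ^ m * EQ c.lam (m + (n - 1) + 1)) := by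
    refine sum_congr rfl fun m _ => ?_; ring
  rw [hrhs, hre]
  change _ = ∑ i ∈ range (c.cnt n), _
  rw [Nat.cast_mul, Nat.cast_pow, Nat.cast_sum, Finset.mul_sum, Finset.sum_div]
  refine sum_congr rfl fun i hi => ?_
  rw [mem_range] at hi
  have hiK : i ≤ c.K := by omega
  rw [Nat.cast_mul, Nat.cast_mul, hwv i hiK, expSeq_getD _ _ _ _ hi]
  -- `C(m+n', n') = (m+n')!/(m! n'!)`
  have hch : ((((2 * i + c.A) + (n - 1)).choose (n - 1) : ℕ) : ℚ)
      = (((2 * i + c.A) + (n - 1))! : ℚ) / ((((2 * i + c.A))! : ℚ) * (((n - 1))! : ℚ)) := by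
    rw [eq_div_iff (by positivity), ← mul_assoc]
    exact_mod_cast Nat.add_choose_mul_factorial_mul_factorial (2 * i + c.A) (n - 1)
  rw [hch, show c.A + (n - 1) + 2 * i = 2 * i + c.A + (n - 1) by ring]
  -- powers: `484^(K+1-cnt) · 484^(cnt-1-i) · 22^(2i+A) = 22^Mh`
  have hpow : (484 : ℚ) ^ (c.K + 1 - c.cnt n) * (484 : ℚ) ^ (c.cnt n - 1 - i) * (22 : ℚ) ^ (2 * i + c.A)
      = (22 : ℚ) ^ c.Mh := by
    rw [show (484 : ℚ) = 22 ^ 2 by norm_num, ← pow_mul, ← pow_mul, ← pow_add, ← pow_add]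
    congr 1; omega
  have h22' : (22 : ℚ) ^ (2 * i + c.A) ≠ 0 := by positivity
  have h484a : (484 : ℚ) ^ (c.K + 1 - c.cnt n) ≠ 0 := by positivity
  have h484b : (484 : ℚ) ^ (c.cnt n - 1 - i) ≠ 0 := by positivity
  have hf1 : (((2 * i + c.A))! : ℚ) ≠ 0 := by positivity
  have hf2 : (((n - 1))! : ℚ) ≠ 0 := by positivity
  have hf3 : ((c.Mh)! : ℚ) ≠ 0 := by positivity
  push_cast
  rw [← hpow]
  field_simp


/-- `E_k(λ)` cast to `ℝ` is `expPartial`. [folklore] -/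
theorem cast_EQ (lam k : ℕ) : ((EQ lam k : ℚ) : ℝ) = expPartial (lam : ℝ) k := by
  rw [EQ, expPartial]; push_cast; rfl

/-- **`P_n` in `ℝ`**: `P_n = Σ_{m<M n} C(m+n',n') p_m(x; 11)`. [folklore] -/
theorem Pq_real (hp : c.Params) (hcs : ∀ i, coordD x i = ((c.avals.getD i 0 : ℕ) : ℤ))
    (n : ℕ) (hn1 : 1 ≤ n) (hn4 : n ≤ 4) :
    ((c.Pq c.what n : ℚ) : ℝ) = ∑ m ∈ range (c.M n),
      (((m + (n - 1)).choose (n - 1) : ℕ) : ℝ) * srwLaw 11 m x := by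
  rw [Pq_eq hp hcs n hn1 hn4]
  push_cast
  refine sum_congr rfl fun m _ => ?_
  have h22 : (2 * ((11 : ℕ) : ℝ)) = 22 := by norm_num
  rw [srwLaw_eq_srwCount_div, h22, srwCount]
  ring

/-- **`U_n` in `ℝ`**: `U_n = Σ_{m<M n} C(m+n',n') p_m(x; 11) E_{m+n'+1}(λ)`. [folklore] -/
theorem Uq_real (hp : c.Params) (hcs : ∀ i, coordD x i = ((c.avals.getD i 0 : ℕ) : ℤ))
    (n : ℕ) (hn1 : 1 ≤ n) (hn4 : n ≤ 4) :
    ((c.Uq c.what n : ℚ) : ℝ) = ∑ m ∈ range (c.M n),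
      (((m + (n - 1)).choose (n - 1) : ℕ) : ℝ) * srwLaw 11 m x * expPartial (c.lam : ℝ) (m + (n - 1) + 1) := by
  rw [Uq_eq hp hcs n hn1 hn4]
  push_cast
  refine sum_congr rfl fun m _ => ?_
  have h22 : (2 * ((11 : ℕ) : ℝ)) = 22 := by norm_num
  rw [srwLaw_eq_srwCount_div, h22, cast_EQ, srwCount]
  ring

end Cert

end Literature.Probability.FitznerVanDerHofstad2017.SeedCert
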